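import Summits.CriticalPhenomena.PercolationContinuityZ3.Theorems.PercNearOneGluingNoHeavyQuantElemSymmBound
import Mathlib.Data.List.Sort
import HarnessLib

/-!
# QUANT lane R8, T-DEC: BINOMIAL EXTREMALITY of the elementary-symmetric masses in the near-one regime `γᵢ ≥ 1/2`
# (census-1 gen 31) — the second half of the long-tail route bound

builds on p205010 (kernel theorem, internal audit signed; external expert review pending)

Support file (`--supports stmt-CriticalPhenomena-4575`), QUANT lane seat prim-quant-census-1 (gen 31); memo
`run/shared/lean/prim/quant/prim-quant-census-1/g31/HUB-GENERAL-G31.md` §0 (7).  Theorems only, standard axioms, no sorries.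

THE FACT.  For gates `γ₁,…,γ_n ∈ [1/2, 1)` with mean `c`, the elementary symmetric polynomials of the odds `oᵢ = γᵢ/(1−γᵢ)` are at least those
of the EQUAL configuration: **`e_r(o) ≥ C(n, r)·(c/(1−c))^r`** (`esL_odds_binomial`).  Equivalently `γ ↦ e_r(odds γ)` is Schur-convex on
`[1/2,1)ⁿ` (found numerically, memo §0 (7): 0 violations in 30 000 random equalising transfers; it FAILS below `1/2`).  Proof: two-point smoothing
— for `a ≤ p ≤ b`, `q = a + b − p`, `a + b ≥ 1`: `o(p) + o(q) ≤ o(a) + o(b)` (convexity; `= (2−a−b)(p−a)(b−p)/…`) and `o(p)o(q) ≤ o(a)o(b)`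
(`= (a+b−1)(p−a)(b−p)/…`, this is where `γ ≥ 1/2` enters), so replacing `(a, b)` by `(c, a+b−c)` for `a < c < b` lowers every `e_r`
(`esL_pair_smooth`, via `e_r(x::y::M) = e_r(M) + (x+y)e_{r−1}(M) + xy·e_{r−2}(M)`) and strictly lowers the number of entries `≠ c`; at the end
`e_r(c,…,c) = C(n,r)o(c)^r` (`esL_replicate`).
CONSEQUENCE (`sHub_routeBound_nearOne`, with `…QuantElemSymmBound.sHub_routeBoundES`): for the hub of shape `(lo, K)` with gates in `[1/2,1)`,
`Λ = Σγᵢ`, `s < j`, and any `c ∈ [1/2, 1)` with `c·(j−s) ≤ Λ − s` (a certified lower bound for the mean of the `j−s` smallest gates):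
  **`u(lo·j + K·s) · C(j−s, r)·(c/(1−c))^r ≤ C(s+r, s) · u(lo·j + K·(s+r))`.**
This is the closed-form route bound the long-tail capacity discharge needs (memo §0 (7): with the farthest-near rule `sdec_farthestNear` it certifies
every tested hub with `γᵢ ≥ 1/2` at the widths `lo·j ≥ 2K`; the remaining one-dimensional inequality is the successor's item).

HONEST STATUS.  A tool; no census row changes.  `SiblingStep`, `GluedDominated'`, `SDECConvClosed`, `FarTreeRow` OPEN; RATE class (log\*) / honest
sentence of `run/shared/lean/prim/quant/README.md` unchanged.  [this work].  Nothing here is cited as a published result.  The gluing rows served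
[cite: KozmaNitzan2024, Conjecture 3 (p. 15)]; product measure [cite: Grimmett1999, §1.3 p. 10].
-/

noncomputable section

open scoped BigOperators

namespace Summit.CriticalPhenomena.PercolationContinuityZ3.Theorems
namespace Quant
namespace LawDec

open Finset

/-! ### Two-point smoothing of the odds -/

/-- SUM part: for `a ≤ p ≤ b < 1`, `q = a + b − p`: `o(p) + o(q) ≤ o(a) + o(b)` (convexity of the odds). [this work] -/
theorem odds_pair_sum_le (a b p : ℝ) (hap : a ≤ p) (hpb : p ≤ b) (hb : b < 1) :
    p / (1 - p) + (a + b - p) / (1 - (a + b - p)) ≤ a / (1 - a) + b / (1 - b) := by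
  have h1 : 0 < 1 - a := by linarith
  have h2 : 0 < 1 - b := by linarith
  have h3 : 0 < 1 - p := by linarith
  have h4 : 0 < 1 - (a + b - p) := by linarith
  have key : a / (1 - a) + b / (1 - b) - (p / (1 - p) + (a + b - p) / (1 - (a + b - p)))
      = (2 - a - b) * ((p - a) * (b - p)) / ((1 - a) * (1 - b) * (1 - p) * (1 - (a + b - p))) := by
    field_simp
    ring
  have hnum : 0 ≤ (2 - a - b) * ((p - a) * (b - p)) := mul_nonneg (by linarith) (mul_nonneg (by linarith) (by linarith))
  have : 0 ≤ a / (1 - a) + b / (1 - b) - (p / (1 - p) + (a + b - p) / (1 - (a + b - p))) := by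
    rw [key]; positivity
  linarith

/-- PRODUCT part: for `a ≤ p ≤ b < 1`, `q = a + b − p` and `a + b ≥ 1` (the near-one regime): `o(p)·o(q) ≤ o(a)·o(b)`. [this work] -/
theorem odds_pair_prod_le (a b p : ℝ) (hap : a ≤ p) (hpb : p ≤ b) (hb : b < 1) (hab : 1 ≤ a + b) :
    p / (1 - p) * ((a + b - p) / (1 - (a + b - p))) ≤ a / (1 - a) * (b / (1 - b)) := by
  have h1 : 0 < 1 - a := by linarith
  have h2 : 0 < 1 - b := by linarith
  have h3 : 0 < 1 - p := by linarith
  have h4 : 0 < 1 - (a + b - p) := by linarith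
  have key : a / (1 - a) * (b / (1 - b)) - p / (1 - p) * ((a + b - p) / (1 - (a + b - p)))
      = (a + b - 1) * ((p - a) * (b - p)) / ((1 - a) * (1 - b) * (1 - p) * (1 - (a + b - p))) := by
    field_simp
    ring
  have hnum : 0 ≤ (a + b - 1) * ((p - a) * (b - p)) := mul_nonneg (by linarith) (mul_nonneg (by linarith) (by linarith))
  have : 0 ≤ a / (1 - a) * (b / (1 - b)) - p / (1 - p) * ((a + b - p) / (1 - (a + b - p))) := by
    rw [key]; positivity
  linarith

/-- two leading entries: `e_{k+2}(x :: y :: M) = e_{k+2}(M) + (x+y)·e_{k+1}(M) + xy·e_k(M)`. [this work] -/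
theorem esL_cons_cons (x y : ℝ) (M : List ℝ) (k : ℕ) :
    esL (x :: y :: M) (k + 2) = esL M (k + 2) + (x + y) * esL M (k + 1) + x * y * esL M k := by
  rw [show k + 2 = (k + 1) + 1 by ring, esL_cons_succ, esL_cons_succ, esL_cons_succ]; ring

/-- **two-point smoothing lowers every `e_r`**: with `a ≤ p ≤ b < 1`, `a + b ≥ 1`, `q = a + b − p`, and `M` nonnegative,
`e_r(o(p) :: o(q) :: M) ≤ e_r(o(a) :: o(b) :: M)`. [this work] -/
theorem esL_pair_smooth (a b p : ℝ) (hap : a ≤ p) (hpb : p ≤ b) (hb : b < 1) (hab : 1 ≤ a + b)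
    (M : List ℝ) (hM : ∀ z ∈ M, 0 ≤ z) : ∀ r : ℕ,
    esL (p / (1 - p) :: (a + b - p) / (1 - (a + b - p)) :: M) r ≤ esL (a / (1 - a) :: b / (1 - b) :: M) r
  | 0 => by simp
  | 1 => by
    simp only [esL_cons_succ, esL_zero, mul_one]
    linarith [odds_pair_sum_le a b p hap hpb hb]
  | k + 2 => by
    rw [esL_cons_cons, esL_cons_cons]
    have hS := odds_pair_sum_le a b p hap hpb hb
    have hP := odds_pair_prod_le a b p hap hpb hb hab
    have e1 := esL_nonneg M hM (k + 1)
    have e0 := esL_nonneg M hM k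
    nlinarith [mul_le_mul_of_nonneg_right hS e1, mul_le_mul_of_nonneg_right hP e0]

/-- the equal configuration: `e_k(x, …, x) = C(n, k)·x^k`. [this work] -/
theorem esL_replicate (x : ℝ) : ∀ n k : ℕ, esL (List.replicate n x) k = ((n.choose k : ℕ) : ℝ) * x ^ k
  | 0, 0 => by simp
  | 0, k + 1 => by simp
  | n + 1, 0 => by simp
  | n + 1, k + 1 => by
    rw [List.replicate_succ, esL_cons_succ, esL_replicate x n (k + 1), esL_replicate x n k, Nat.choose_succ_succ]
    push_cast; ring

/-! ### Mean facts -/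

/-- entries `≤ c`, one of them `< c` ⟹ `sum < c·length`. [this work] -/
theorem sum_lt_of_forall_le_exists_lt (c : ℝ) : ∀ L : List ℝ, (∀ x ∈ L, x ≤ c) → (∃ x ∈ L, x < c) → L.sum < c * L.length
  | [], _, hex => by obtain ⟨x, hx, _⟩ := hex; simp at hx
  | y :: L, hle, hex => by
    rw [List.sum_cons, List.length_cons]; push_cast
    have hy : y ≤ c := hle y (by simp)
    have hL : ∀ x ∈ L, x ≤ c := fun x hx => hle x (List.mem_cons_of_mem y hx)
    have hsumle : ∀ L' : List ℝ, (∀ x ∈ L', x ≤ c) → L'.sum ≤ c * L'.length := by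
      intro L' h'
      induction L' with
      | nil => simp
      | cons z L' ih =>
        rw [List.sum_cons, List.length_cons]; push_cast
        have := ih (fun x hx => h' x (List.mem_cons_of_mem z hx))
        nlinarith [h' z (by simp)]
    obtain ⟨x, hx, hxc⟩ := hex
    rcases List.mem_cons.mp hx with rfl | hxL
    · nlinarith [hsumle L hL]
    · nlinarith [sum_lt_of_forall_le_exists_lt c L hL ⟨x, hxL, hxc⟩]

/-- entries `≥ c`, one of them `> c` ⟹ `c·length < sum`. [this work] -/
theorem lt_sum_of_forall_ge_exists_gt (c : ℝ) : ∀ L : List ℝ, (∀ x ∈ L, c ≤ x) → (∃ x ∈ L, c < x) → c * L.length < L.sum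
  | [], _, hex => by obtain ⟨x, hx, _⟩ := hex; simp at hx
  | y :: L, hge, hex => by
    rw [List.sum_cons, List.length_cons]; push_cast
    have hy : c ≤ y := hge y (by simp)
    have hL : ∀ x ∈ L, c ≤ x := fun x hx => hge x (List.mem_cons_of_mem y hx)
    have hsumge : ∀ L' : List ℝ, (∀ x ∈ L', c ≤ x) → c * L'.length ≤ L'.sum := by
      intro L' h'
      induction L' with
      | nil => simp
      | cons z L' ih =>
        rw [List.sum_cons, List.length_cons]; push_cast
        have := ih (fun x hx => h' x (List.mem_cons_of_mem z hx))
        nlinarith [h' z (by simp)]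
    obtain ⟨x, hx, hxc⟩ := hex
    rcases List.mem_cons.mp hx with rfl | hxL
    · nlinarith [hsumge L hL]
    · nlinarith [lt_sum_of_forall_ge_exists_gt c L hL ⟨x, hxL, hxc⟩]

/-- entries in `[1/2, 1)` ⟹ `length/2 ≤ sum` and (nonempty) `sum < length`. [this work] -/
theorem sum_bounds_nearOne : ∀ L : List ℝ, (∀ x ∈ L, 1 / 2 ≤ x ∧ x < 1) → (L.length : ℝ) / 2 ≤ L.sum ∧ (L ≠ [] → L.sum < L.length)
  | [], _ => by simp
  | y :: L, h => by
    have hy := h y (by simp)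
    obtain ⟨h1, h2⟩ := sum_bounds_nearOne L (fun x hx => h x (List.mem_cons_of_mem y hx))
    rw [List.sum_cons, List.length_cons]; push_cast
    refine ⟨by linarith, fun _ => ?_⟩
    by_cases hL : L = []
    · subst hL; simp; linarith [hy.2]
    · linarith [h2 hL]

/-! ### Binomial extremality -/

/-- **binomial extremality** (Schur-convexity of `γ ↦ e_r(odds γ)` on `[1/2,1)ⁿ`): for a list of gates in `[1/2, 1)` with mean `c`,
`C(n, r)·(c/(1−c))^r ≤ e_r(γ₁/(1−γ₁), …, γ_n/(1−γ_n))`.  (Induction on the number of entries different from the mean, by two-point smoothing.)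
[this work] -/
theorem esL_odds_binomial : ∀ (m : ℕ) (L : List ℝ),
    (L.filter (fun γ => γ ≠ L.sum / L.length)).length = m → (∀ γ ∈ L, 1 / 2 ≤ γ ∧ γ < 1) → ∀ r : ℕ,
    ((L.length.choose r : ℕ) : ℝ) * (L.sum / L.length / (1 - L.sum / L.length)) ^ r ≤ esL (L.map (fun γ => γ / (1 - γ))) r := by
  intro m
  induction m using Nat.strong_induction_on with
  | _ m IH =>
    intro L hm hL r
    set n : ℕ := L.length with hn
    set c : ℝ := L.sum / n with hc
    by_cases hm0 : m = 0
    · -- every entry equals the mean: the equal configuration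
      subst hm0
      have hall : ∀ γ ∈ L, γ = c := by
        intro γ hγ
        have := List.filter_eq_nil_iff.mp (List.length_eq_zero_iff.mp hm) γ hγ
        simpa using this
      have hrep : L = List.replicate n c := List.eq_replicate_iff.mpr ⟨hn.symm, hall⟩
      have hmap : L.map (fun γ => γ / (1 - γ)) = List.replicate n (c / (1 - c)) := by
        rw [hrep, List.map_replicate]
      rw [hmap, esL_replicate]
    · -- pick `a < c < b` in `L`
      have hn0 : L ≠ [] := by
        intro h; subst h; simp at hm; exact hm0 hm.symm
      have hnpos : (0 : ℝ) < n := by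
        have : 0 < L.length := List.length_pos_iff.mpr hn0
        exact_mod_cast this
      have hsum : L.sum = c * n := by rw [hc]; field_simp
      obtain ⟨z, hz⟩ := List.exists_mem_of_length_pos (l := L.filter (fun γ => γ ≠ c)) (by rw [hm]; omega)
      rw [List.mem_filter] at hz
      obtain ⟨hzL, hzc⟩ := hz
      have hzc' : z ≠ c := by simpa using hzc
      have hexa : ∃ a ∈ L, a < c := by
        by_contra hcon
        push Not at hcon
        have hgt : ∃ x ∈ L, c < x := by
          rcases lt_or_gt_of_ne hzc' with h | h
          · exact absurd (hcon z hzL) (not_le.mpr h)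
          · exact ⟨z, hzL, h⟩
        have := lt_sum_of_forall_ge_exists_gt c L hcon hgt
        linarith
      have hexb : ∃ b ∈ L, c < b := by
        by_contra hcon
        push Not at hcon
        have hlt : ∃ x ∈ L, x < c := hexa
        have := sum_lt_of_forall_le_exists_lt c L hcon hlt
        linarith
      obtain ⟨a, haL, hac⟩ := hexa
      obtain ⟨b, hbL, hcb⟩ := hexb
      have hab : a ≠ b := by intro h; subst h; linarith
      -- `L ~ a :: b :: L₀`
      set L₀ : List ℝ := (L.erase a).erase b with hL₀
      have hbLa : b ∈ L.erase a := (List.mem_erase_of_ne (Ne.symm hab)).mpr hbL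
      have hperm : L.Perm (a :: b :: L₀) :=
        (List.perm_cons_erase haL).trans (List.Perm.cons a (List.perm_cons_erase hbLa))
      have hmemL₀ : ∀ x ∈ L₀, x ∈ L := fun x hx => hperm.symm.mem_iff.mp (by simp [hx])
      have ha := hL a haL
      have hb := hL b hbL
      -- the smoothed list
      set L' : List ℝ := c :: (a + b - c) :: L₀ with hL'
      have hlen' : L'.length = n := by
        have := hperm.length_eq; simp [hL'] at this ⊢; omega
      have hsum' : L'.sum = L.sum := by
        rw [hperm.sum_eq]; simp [hL']; ring
      have hmean' : L'.sum / L'.length = c := by rw [hsum', hlen', hc]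
      have hc_lo : 1 / 2 ≤ c := by
        obtain ⟨h1, _⟩ := sum_bounds_nearOne L hL
        rw [hc, le_div_iff₀ hnpos]; linarith
      have hc_hi : c < 1 := by
        obtain ⟨_, h2⟩ := sum_bounds_nearOne L hL
        rw [hc, div_lt_iff₀ hnpos]; linarith [h2 hn0]
      have hL'b : ∀ γ ∈ L', 1 / 2 ≤ γ ∧ γ < 1 := by
        intro γ hγ
        simp only [hL', List.mem_cons] at hγ
        rcases hγ with rfl | rfl | hγ
        · exact ⟨hc_lo, hc_hi⟩
        · exact ⟨by linarith [ha.1], by linarith [hb.2]⟩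
        · exact hL γ (hmemL₀ γ hγ)
      -- the measure drops
      have hmL : m = (L₀.filter (fun γ => γ ≠ c)).length + 2 := by
        have e1 : (L.filter (fun γ => γ ≠ L.sum / L.length)).length = ((a :: b :: L₀).filter (fun γ => γ ≠ c)).length :=
          (hperm.filter _).length_eq
        rw [← hm, e1]
        simp [ne_of_lt hac, ne_of_gt hcb]
      have hm' : (L'.filter (fun γ => γ ≠ L'.sum / L'.length)).length < m := by
        rw [hmean', hmL]
        have hcc : decide (c ≠ c) = false := by simp
        have hle : (L'.filter (fun γ => γ ≠ c)).length ≤ (L₀.filter (fun γ => γ ≠ c)).length + 1 := by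
          simp only [hL', List.filter_cons, hcc, Bool.false_eq_true, ↓reduceIte]
          split_ifs <;> simp
        omega
      -- induction hypothesis for `L'`, then smoothing, then the permutation
      have IH' := IH _ hm' L' rfl hL'b r
      rw [hmean', hlen'] at IH'
      have hsm : esL (L'.map (fun γ => γ / (1 - γ))) r ≤ esL ((a :: b :: L₀).map (fun γ => γ / (1 - γ))) r := by
        simp only [hL', List.map_cons]
        exact esL_pair_smooth a b c hac.le hcb.le hb.2 (by linarith [ha.1, hb.1])
          (L₀.map (fun γ => γ / (1 - γ))) (fun z hz => by
            obtain ⟨y, hy, rfl⟩ := List.mem_map.mp hz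
            have := hL y (hmemL₀ y hy)
            exact div_nonneg (by linarith [this.1]) (by linarith [this.2])) r
      rw [esL_perm (hperm.map (fun γ => γ / (1 - γ))) r]
      exact IH'.trans hsm

/-- **binomial extremality, packaged**: gates in `[1/2,1)`, `n = |L| ≥ 1`, any `c ∈ [1/2,1)` with `c·n ≤ ΣL` ⟹ `C(n,r)(c/(1−c))^r ≤ e_r(odds)`.
[this work] -/
theorem esL_odds_ge_binomial (L : List ℝ) (hL : ∀ γ ∈ L, 1 / 2 ≤ γ ∧ γ < 1) (hn : L ≠ []) (c : ℝ) (hc0 : 0 ≤ c) (hc1 : c < 1)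
    (hcL : c * L.length ≤ L.sum) (r : ℕ) :
    ((L.length.choose r : ℕ) : ℝ) * (c / (1 - c)) ^ r ≤ esL (L.map (fun γ => γ / (1 - γ))) r := by
  have hnpos : (0 : ℝ) < L.length := by
    have : 0 < L.length := List.length_pos_iff.mpr hn
    exact_mod_cast this
  have hmain := esL_odds_binomial _ L rfl hL r
  set c' : ℝ := L.sum / L.length with hc'
  have hcc' : c ≤ c' := by rw [hc', le_div_iff₀ hnpos]; exact hcL
  have hc'1 : c' < 1 := by
    obtain ⟨_, h2⟩ := sum_bounds_nearOne L hL
    rw [hc', div_lt_iff₀ hnpos]; linarith [h2 hn]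
  have hodds : c / (1 - c) ≤ c' / (1 - c') := by
    rw [div_le_div_iff₀ (by linarith) (by linarith)]; nlinarith
  have hpow : (c / (1 - c)) ^ r ≤ (c' / (1 - c')) ^ r :=
    pow_le_pow_left₀ (div_nonneg hc0 (by linarith)) hodds r
  exact le_trans (mul_le_mul_of_nonneg_left hpow (Nat.cast_nonneg _)) hmain

/-! ### The near-one route bound for the hub of shape `(lo, K)` -/

/-- **the closed-form long-tail route bound in the near-one regime**: `lo < K`, gates `γᵢ ∈ [1/2, 1)` with sum `Λ`, `s < j = |P|`, and any
`c ∈ [1/2, 1)` with `c·(j − s) ≤ Λ − s` ⟹ `u(lo·j + K·s) · C(j−s, r)·(c/(1−c))^r ≤ C(s+r, s) · u(lo·j + K·(s+r))`. [this work] -/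
theorem sHub_routeBound_nearOne (lo K : ℕ) (hloK : lo < K) (P : List ℝ) (hP : ∀ γ ∈ P, 1 / 2 ≤ γ ∧ γ < 1)
    (s r : ℕ) (hs : s < P.length) (c : ℝ) (hc : 1 / 2 ≤ c) (hc1 : c < 1)
    (hcs : c * (((P.length - s : ℕ)) : ℝ) ≤ P.sum - s) :
    sHub lo K P (lo * P.length + K * s) * ((((P.length - s).choose r : ℕ) : ℝ) * (c / (1 - c)) ^ r)
      ≤ ((s + r).choose s : ℝ) * sHub lo K P (lo * P.length + K * (s + r)) := by
  -- sort the gates; the odds of the sorted gates are sorted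
  set P' : List ℝ := P.insertionSort (· ≤ ·) with hP'
  have hperm : P'.Perm P := List.perm_insertionSort _ P
  have hsort : P'.Pairwise (· ≤ ·) := List.pairwise_insertionSort _ P
  have hP'b : ∀ γ ∈ P', 1 / 2 ≤ γ ∧ γ < 1 := fun γ hγ => hP γ (hperm.mem_iff.mp hγ)
  set od : ℝ → ℝ := fun γ => γ / (1 - γ) with hod
  have hOperm : (P'.map od).Perm (P.map od) := hperm.map od
  have hOsort : (P'.map od).Pairwise (· ≤ ·) := by
    rw [List.pairwise_map]
    refine hsort.imp_of_mem ?_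
    intro a b ha hb hab
    have ha' := hP'b a ha; have hb' := hP'b b hb
    show a / (1 - a) ≤ b / (1 - b)
    rw [div_le_div_iff₀ (by linarith) (by linarith)]; nlinarith
  have hP01 : ∀ γ ∈ P, 0 ≤ γ ∧ γ < 1 := fun γ hγ => ⟨by linarith [(hP γ hγ).1], (hP γ hγ).2⟩
  have hES := sHub_routeBoundES lo K hloK P hP01 (P'.map od) hOperm hOsort s r hs.le
  -- the `j − s` smallest gates
  set n : ℕ := P.length - s with hn
  set L : List ℝ := P'.take n with hL
  have hlenP' : P'.length = P.length := hperm.length_eq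
  have hLlen : L.length = n := by rw [hL, List.length_take]; omega
  have hLne : L ≠ [] := by
    intro h; have := congrArg List.length h; rw [hLlen] at this; simp at this; omega
  have hLb : ∀ γ ∈ L, 1 / 2 ≤ γ ∧ γ < 1 := fun γ hγ => hP'b γ (List.mem_of_mem_take hγ)
  have htake : (P'.map od).take n = L.map od := by rw [hL, List.map_take]
  -- its sum is at least `Λ − s`
  have hdrop_len : (P'.drop n).length = s := by rw [List.length_drop]; omega
  have hdrop_sum : (P'.drop n).sum ≤ s := by
    have : ∀ M : List ℝ, (∀ γ ∈ M, γ < 1) → M.sum ≤ M.length := by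
      intro M hM
      induction M with
      | nil => simp
      | cons y M ih =>
        rw [List.sum_cons, List.length_cons]; push_cast
        have := ih (fun γ hγ => hM γ (List.mem_cons_of_mem y hγ))
        linarith [hM y (by simp)]
    have h := this (P'.drop n) (fun γ hγ => (hP'b γ (List.mem_of_mem_drop hγ)).2)
    rw [hdrop_len] at h; exact h
  have hLsum : c * L.length ≤ L.sum := by
    have hsplit : L.sum + (P'.drop n).sum = P.sum := by
      rw [hL, ← List.sum_append, List.take_append_drop, hperm.sum_eq]
    rw [hLlen]; linarith
  have hbin := esL_odds_ge_binomial L hLb hLne c (by linarith) hc1 hLsum r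
  rw [hLlen] at hbin
  rw [htake] at hES
  have hu0 : 0 ≤ sHub lo K P (lo * P.length + K * s) :=
    (sHub_laws lo K P (fun γ hγ => ⟨(hP01 γ hγ).1, (hP01 γ hγ).2.le⟩)).1 _
  exact le_trans (mul_le_mul_of_nonneg_left hbin hu0) hES

end LawDec
end Quant
end Summit.CriticalPhenomena.PercolationContinuityZ3.Theorems
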